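import Summits.BirchSwinnertonDyer.Rank1Residual.AdditivePotMult.ChiEigenSelmerDual
import HarnessLib

/-!
# The prime-to-`p` EIGEN-descent `ℚ(μ_{p^∞}) → ℚ_∞(√p*)` on the `ω^{(p−1)/2} = χ_K`-component, in the
# kernel: `Sel_{p^∞}(E♭/K·ℚ_∞)^{(χ_K)} ≃ Sel_{p^∞}(E♭/F·K·ℚ_∞)^{(χ_K)}` for `p ∤ [F : ℚ]`
# (cell `b2b-bsdres`, sub-cell additive-p2, gen 12)

HONEST FRAMING (cell `b2b-bsdres`, run/shared/lean/b2b/bsd-rank1-residual/, verbatim in every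
file): the goal of the cell is to DELETE the COMBINATION-SHAPED residual classes of the
Birch–Swinnerton-Dyer formula for ALL analytic-rank `≤ 1` elliptic curves over `ℚ` — "full BSD
formula for every rank `≤ 1` curve in class `C`" assembled STRICTLY from published theorems — so
that the rank-`≤ 1` remainder becomes exactly the CONSTRUCTION-SHAPED classes, which are TYPED
(missing-input `Prop`s), NOT attempted. This is not "finishing BSD". Sub-cell `additive-p2`
(CLASS-OWNERS row "X3/X4 additive — pot. good ordinary / X3♯(G-ord)"), generation 12: research
route; no claim beyond the stated classes; X3♯(G-ord)/X4♯(G-ord) stay CONSTRUCTION-SHAPED; labels /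
census / located gap UNCHANGED; nothing is booked. Definitions = one `AddSubgroup` (the exact `F`-level
analogue of additive-p1's `chiEigenSelmer`) and concrete maps; theorems; no predicate, no hypothesis
structure (that is the sequel `…Dual.lean`), no named fact.

WHY. After additive-p1's kernel transport [C] (`TwistDescent`, `ChiEigenSelmerDual`, gen 8:
`Sel_{p^∞}(E/ℚ_∞) ≃ Sel_{p^∞}(E♭/K·ℚ_∞)^{(χ_K)}` for `E = E♭ ⊗ χ_K`, `K` quadratic, `p` odd) the ONLY
unprinted input of the typed `χ_p`-branch predicates `ChiBranchLeadingTerm[Odd][BigImage]At W p`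
(additive-p4; consumers: additive-p1's `RankZeroChiBranch*`, additive-p2's `GordRankZeroChiBranch`,
additive-p4's V9/V9b) is the COMPONENTWISE reading of Kato 2004 Thm. 17.4 (3) / Wuthrich 2014
Thm. 16 ("brick 4" of HOME/b2b-bsdres-additive-p1/KERNEL-C-P3.md). Those theorems are printed over
the full cyclotomic tower `ℚ(μ_{p^∞}) = F·ℚ_∞`, `F = ℚ(ζ_p)`, as a statement about the
`Λ(Gal(ℚ(μ_{p^∞})/ℚ)) = ⊕_{i mod p−1} Λ(Γ)e_i`-module `X(E♭/ℚ(μ_{p^∞}))`, i.e. about EACH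
eigen-component `e_i X` (Wuthrich §3 p. 390: `M = ⊕ M_i`). At `p = 3`, `F = K = ℚ(√−3)` and the
`e₁`-component IS additive-p1's `χ_K`-eigenspace. At `p ≥ 5` the `e_{(p−1)/2}`-component of
`Sel_{p^∞}(E♭/ℚ(μ_{p^∞}))` is the `χ_K`-eigenspace of the `Δ = Gal(ℚ(μ_{p^∞})/ℚ_∞)`-action for
`K = ℚ(√p*) ⊂ F` (`ω^{(p−1)/2}(δ) = χ_K(δ|_K)`), and it has to be DESCENDED to `K·ℚ_∞ = ℚ_∞(√p*)`
along `Gal(ℚ(μ_{p^∞})/ℚ_∞(√p*)) = Δ²`, of order `(p−1)/2` PRIME TO `p` — "the remaining prime-to-`p`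
descent `ℚ(μ_{p^∞}) → ℚ_∞(√p*)` is again `PrimeToPDescent`" (additive-p1, `TwistDescent.lean`,
module docstring). THIS FILE does that descent, in the kernel, in additive-p1's vocabulary (the
subgroup model of Selmer groups over `Γ_ℚ`; Greenberg LNM 1716 §5 p. 143):

* `chiEigenSelmerIn V K p κ U` — for a normal subgroup `U ≤ Γ_ℚ` (meant: `U = galRange F =
  Gal(ℚ̄/F)`, `F/ℚ` Galois): the classes of `Sel_{p^∞}(E♭/ℚ̄^{ker κ ⊓ Gal(ℚ̄/K) ⊓ U})`
  (`= Sel_{p^∞}(E♭/F·K·ℚ_∞)`) on which every `g ∈ Gal(ℚ̄/ℚ_∞) = ker κ` acts through `χ_K`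
  (`quadSign K`); for `U = galRange F`, `F = ℚ(ζ_p) ⊃ K = ℚ(√p*)`, this is
  `e_{(p−1)/2}·Sel_{p^∞}(E♭/ℚ(μ_{p^∞}))`;
* `chiEigenRestrictionEquiv` — **for `U` open with `p ∤ [Γ_ℚ : U]` the restriction map is an
  isomorphism `chiEigenSelmer V K p κ ≃+ chiEigenSelmerIn V K p κ U`**, commuting with `g_*` for
  EVERY `g ∈ Γ_ℚ` (`coe_chiEigenRestrictionEquiv_conjH1`): additive-p1's
  `selmerRelRestriction_bijective_of_coprime` (Greenberg p. 143 for `E[p^∞]`, closed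
  `H' = ker κ ⊓ Gal(ℚ̄/K)`, `H = H' ⊓ U`) restricted to the eigenspaces — a `χ_K`-variant class
  downstairs is automatically `H'`-invariant, and the eigen-condition of the preimage follows from
  injectivity;
SEQUELS (same generation): `ChiEigenPrimeToPDescentDual.lean` — the `Λ`-dual datum
`ChiEigenSelmerInDualData V K κ U γ` of the `F`-level eigenspace and the transport of additive-p1's
`K`-level datum / of any `W.SelmerDualData κ γ` to it with the SAME module;
`ChiEigenPrimeToPDescentGenerator.lean` — generator normalisation into `Gal(ℚ̄/K) ⊓ U`, the
cyclotomic case `U = galRange ℚ(ζ_p)` (index `p − 1`, prime to `p`) and the end-to-end packaging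
`SelmerDualData.exists_chiEigenInCyclotomic`.

So the componentwise reading-fact (brick 4′, every odd `p`) can be stated PRINT-FAITHFULLY at the
level of `ℚ(μ_{p^∞})` — "for `D : ChiEigenSelmerInDualData V K κ (galRange F) γ`, `F = ℚ(ζ_p)`,
`K = ℚ(√p*)`, `γ ∈ Gal(ℚ̄/K) ⊓ Gal(ℚ̄/F)` a topological generator matching the cyclotomic variable:
`D.X` is `Λ`-torsion and `char_Λ D.X ∋ u·ϖ^{±}·L_p(E♭, ω^{(p−1)/2}, T)`" (Kato 17.4 (3), component
`i = (p−1)/2`; resp. Wuthrich Thm. 16) — and it reaches `X(E/ℚ_∞)` for every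
`D : W.SelmerDualData κ γ` by the kernel alone (these three files ∘ additive-p1's bricks 1–3 and
`GeneratorNormalisation`), at EVERY odd `p`; at `p = 3` (`F = K`) it is additive-p1's brick 4
verbatim. Nothing here is specific to X3/X4; the located gap (the LOWER, Eisenstein half on the
`ω^{(p−1)/2}`-branch) is untouched; labels UNCHANGED.

References: R. Greenberg, *Iwasawa theory for elliptic curves*, LNM 1716 (1999), §5 p. 143 (the
restriction isomorphism `H¹(ℚ_Σ/ℚ_∞, C) ≅ H¹(ℚ_Σ/F_∞, C)^Δ` "taking into account the local
conditions") and §1 p. 60 [GreenbergLNM1716]; C. Wuthrich, Doc. Math. 19 (2014) §3 p. 390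
(`M = ⊕_i M_i`) [Wuthrich2014]; K. Kato, Astérisque 295 (2004) §17.3, Thm. 17.4
[Kato2004Asterisque]; L. Washington, *Introduction to Cyclotomic Fields*, §13.1 [Washington1997].
-/

noncomputable section

open scoped Classical

namespace Summit.BirchSwinnertonDyer.Rank1Residual.Additive

open Literature.NumberTheory.EllipticCurves Literature.NumberTheory.GaloisRepresentations
  WeierstrassCurve Summit.BirchSwinnertonDyer.Rank1Residual.AdditivePotMult

/-! ## §1 The `F`-level eigenspace `Sel_{p^∞}(E♭/F·K·ℚ_∞)^{(χ_K)}` -/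

section EigenIn

variable (V : WeierstrassCurve ℚ) (K : Type) [Field K] [NumberField K] (p : ℕ) [Fact p.Prime]
  (κ : ZpExtension ℚ p) [(galRange (K := ℚ) K).Normal]
  (U : Subgroup (Field.absoluteGaloisGroup ℚ)) [U.Normal]

/-- **`Sel_{p^∞}(E♭/F·K·ℚ_∞)^{(χ_K)}`** (`F = ℚ̄^U`): the classes of
`Sel_{p^∞}(V/ℚ̄^{ker κ ⊓ galRange K ⊓ U})` on which every `g ∈ Gal(ℚ̄/ℚ_∞) = ker κ` acts through the
quadratic character of `K` — the `χ_K`-eigenspace of the `Gal(F·K·ℚ_∞/ℚ_∞)`-action. For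
`U = galRange F`, `F = ℚ(ζ_p) ⊃ K = ℚ(√p*)` (so `F·K·ℚ_∞ = ℚ(μ_{p^∞})`): the
`ω^{(p−1)/2}`-eigenspace `e_{(p−1)/2}·Sel_{p^∞}(E♭/ℚ(μ_{p^∞}))` of Kato 2004 §17.3 / Wuthrich 2014 §3
(`ω^{(p−1)/2} = χ_K ∘ res`). The `U = ⊤`-free analogue of additive-p1's `chiEigenSelmer`.
[cite: GreenbergLNM1716, §5 p. 143] -/
def chiEigenSelmerIn :
    AddSubgroup (V.subgroupH1 p (κ.kerSubgroup ⊓ galRange (K := ℚ) K ⊓ U)) where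
  carrier := {t | t ∈ V.selmerGroupOver p (κ.kerSubgroup ⊓ galRange (K := ℚ) K ⊓ U) ∧
    ∀ g : κ.kerSubgroup, V.conjH1 p _ (g : Field.absoluteGaloisGroup ℚ) t = quadSign K g • t}
  zero_mem' := ⟨zero_mem _, fun g ↦ by rw [map_zero, zsmul_zero]⟩
  add_mem' := fun {a b} ha hb ↦
    ⟨add_mem ha.1 hb.1, fun g ↦ by rw [map_add, ha.2 g, hb.2 g, zsmul_add]⟩
  neg_mem' := fun {a} ha ↦ ⟨neg_mem ha.1, fun g ↦ by rw [map_neg, ha.2 g, zsmul_neg]⟩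

/-- Membership in `chiEigenSelmerIn`. [folklore] -/
theorem mem_chiEigenSelmerIn_iff (t : V.subgroupH1 p (κ.kerSubgroup ⊓ galRange (K := ℚ) K ⊓ U)) :
    t ∈ chiEigenSelmerIn V K p κ U ↔
      t ∈ V.selmerGroupOver p (κ.kerSubgroup ⊓ galRange (K := ℚ) K ⊓ U) ∧
        ∀ g : κ.kerSubgroup,
          V.conjH1 p _ (g : Field.absoluteGaloisGroup ℚ) t = quadSign K g • t :=
  Iff.rfl

variable {V K p κ U}

/-- Conjugation by ANY `γ ∈ Γ_ℚ` preserves `chiEigenSelmerIn` (it preserves the Selmer group, and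
`g γ = γ (γ⁻¹ g γ)` with `γ⁻¹ g γ ∈ ker κ` of the same sign, both subgroups being normal). The
`F`-level twin of additive-p1's `conjH1_mem_chiEigenSelmer`. [folklore] -/
theorem conjH1_mem_chiEigenSelmerIn (γ : Field.absoluteGaloisGroup ℚ)
    {t : V.subgroupH1 p (κ.kerSubgroup ⊓ galRange (K := ℚ) K ⊓ U)}
    (ht : t ∈ chiEigenSelmerIn V K p κ U) :
    V.conjH1 p _ γ t ∈ chiEigenSelmerIn V K p κ U := by
  refine ⟨V.map_conjH1_selmerGroupOver_le_holds p _ γ ⟨t, ht.1, rfl⟩, fun g ↦ ?_⟩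
  have hg' : γ⁻¹ * (g : Field.absoluteGaloisGroup ℚ) * γ ∈ κ.kerSubgroup :=
    κ.kerSubgroup_normal.conj_mem' _ g.2 γ
  have h1 : V.conjH1 p _ (g : Field.absoluteGaloisGroup ℚ) (V.conjH1 p _ γ t) =
      V.conjH1 p _ γ (V.conjH1 p _ (γ⁻¹ * (g : Field.absoluteGaloisGroup ℚ) * γ) t) := by
    rw [← AddMonoidHom.comp_apply, ← V.conjH1_mul_holds p, ← AddMonoidHom.comp_apply,
      ← V.conjH1_mul_holds p, ← mul_assoc, ← mul_assoc, mul_inv_cancel, one_mul]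
  rw [h1, ht.2 ⟨_, hg'⟩, map_zsmul]
  congr 1
  by_cases hg : (g : Field.absoluteGaloisGroup ℚ) ∈ galRange (K := ℚ) K
  · rw [quadSign_of_mem K hg, quadSign_of_mem K]
    exact Subgroup.Normal.conj_mem' inferInstance _ hg γ
  · rw [quadSign_of_not_mem K hg, quadSign_of_not_mem K]
    intro h'
    apply hg
    have := Subgroup.Normal.conj_mem inferInstance _ h' γ
    simpa [mul_assoc] using this

/-- An element of `ker κ ⊓ galRange K` acts trivially on `chiEigenSelmerIn` (its sign is `+1`).
[folklore] -/
theorem conjH1_eq_self_of_mem_inf {g : Field.absoluteGaloisGroup ℚ}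
    (hg : g ∈ κ.kerSubgroup ⊓ galRange (K := ℚ) K)
    {t : V.subgroupH1 p (κ.kerSubgroup ⊓ galRange (K := ℚ) K ⊓ U)}
    (ht : t ∈ chiEigenSelmerIn V K p κ U) :
    V.conjH1 p _ g t = t := by
  have h := ht.2 ⟨g, hg.1⟩
  rw [quadSign_of_mem K hg.2, one_smul] at h
  exact h

end EigenIn

/-! ## §2 The restriction `Sel(E♭/K·ℚ_∞)^{(χ)} → Sel(E♭/F·K·ℚ_∞)^{(χ)}` is an isomorphism for `p ∤ [Γ_ℚ : U]` -/

section Restriction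

variable (V : WeierstrassCurve ℚ) [V.IsElliptic] (K : Type) [Field K] [NumberField K] (p : ℕ)
  [Fact p.Prime] (κ : ZpExtension ℚ p) [(galRange (K := ℚ) K).Normal]
  (U : Subgroup (Field.absoluteGaloisGroup ℚ)) [U.Normal]

omit [(galRange (K := ℚ) K).Normal] [U.Normal] in
/-- The inclusion `ker κ ⊓ galRange K ⊓ U ≤ ker κ ⊓ galRange K`. [folklore] -/
theorem inf_le_kerInf : κ.kerSubgroup ⊓ galRange (K := ℚ) K ⊓ U ≤ κ.kerSubgroup ⊓ galRange (K := ℚ) K :=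
  inf_le_left

omit [V.IsElliptic] in
/-- Restriction commutes with conjugation (both subgroups normal in `Γ_ℚ`), elementwise.
[cite: NeukirchSchmidtWingberg2008, I.§5] -/
theorem resOfLe_conjH1 (γ : Field.absoluteGaloisGroup ℚ)
    (s : V.subgroupH1 p (κ.kerSubgroup ⊓ galRange (K := ℚ) K)) :
    V.resOfLe p (inf_le_kerInf K p κ U) (V.conjH1 p _ γ s) =
      V.conjH1 p _ γ (V.resOfLe p (inf_le_kerInf K p κ U) s) :=
  congrArg (fun f ↦ f s)
    (resOfLe_comp_conjH1_holds (M := geomPrimaryTorsion V p) (inf_le_kerInf K p κ U) γ)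

omit [V.IsElliptic] in
/-- Restriction carries `chiEigenSelmer` into `chiEigenSelmerIn`. [folklore] -/
theorem resOfLe_mem_chiEigenSelmerIn {s : V.subgroupH1 p (κ.kerSubgroup ⊓ galRange (K := ℚ) K)}
    (hs : s ∈ chiEigenSelmer V K p κ) :
    V.resOfLe p (inf_le_kerInf K p κ U) s ∈ chiEigenSelmerIn V K p κ U :=
  ⟨V.resOfLe_mem_selmerGroupOver p _ hs.1, fun g ↦ by
    rw [← resOfLe_conjH1, hs.2 g, map_zsmul]⟩

omit [V.IsElliptic] in
/-- A class of `chiEigenSelmerIn` is invariant under `H' = ker κ ⊓ galRange K`, i.e. lies in the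
target `Sel(E♭/ℚ̄^H)^{H'}` of additive-p1's relative restriction. [folklore] -/
theorem mem_selmerGroupOverRelInvariants_of_mem_chiEigenSelmerIn
    {t : V.subgroupH1 p (κ.kerSubgroup ⊓ galRange (K := ℚ) K ⊓ U)}
    (ht : t ∈ chiEigenSelmerIn V K p κ U) :
    t ∈ V.selmerGroupOverRelInvariants p (κ.kerSubgroup ⊓ galRange (K := ℚ) K ⊓ U)
      (κ.kerSubgroup ⊓ galRange (K := ℚ) K) :=
  (V.mem_selmerGroupOverRelInvariants_iff p _).mpr
    ⟨ht.1, fun g ↦ conjH1_eq_self_of_mem_inf (κ := κ) g.2 ht⟩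

variable (hU : IsOpen (U : Set (Field.absoluteGaloisGroup ℚ))) (hcop : U.index.Coprime p)

include hU hcop in
/-- **Additive-p1's prime-to-`p` descent, instantiated**: for `U` open normal with
`p ∤ [Γ_ℚ : U]`, the relative restriction
`Sel(E♭/ℚ̄^{H'}) → Sel(E♭/ℚ̄^{H' ⊓ U})^{H'}`, `H' = ker κ ⊓ galRange K` (closed normal), is a
bijection (`selmerRelRestriction_bijective_of_coprime`; `[H' : H' ⊓ U] ∣ [Γ_ℚ : U]`).
[cite: GreenbergLNM1716, §5 p. 143] -/
theorem selmerRelRestriction_kerInf_bijective :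
    Function.Bijective (V.selmerRelRestriction p (inf_le_kerInf K p κ U)) := by
  haveI : CompactSpace (Field.absoluteGaloisGroup ℚ) := compactSpace_absoluteGaloisGroup ℚ
  haveI : DiscreteTopology (Field.absoluteGaloisGroup ℚ ⧸ U) := QuotientGroup.discreteTopology hU
  haveI : Finite (Field.absoluteGaloisGroup ℚ ⧸ U) := finite_of_compact_of_discrete
  haveI : U.FiniteIndex := Subgroup.finiteIndex_of_finite_quotient
  haveI : ((κ.kerSubgroup ⊓ galRange (K := ℚ) K ⊓ U).subgroupOf
      (κ.kerSubgroup ⊓ galRange (K := ℚ) K)).FiniteIndex := by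
    rw [Subgroup.inf_subgroupOf_left]; infer_instance
  have hrel : (κ.kerSubgroup ⊓ galRange (K := ℚ) K ⊓ U).relIndex
      (κ.kerSubgroup ⊓ galRange (K := ℚ) K) ∣ U.index := by
    rw [Subgroup.inf_relIndex_left]
    exact Subgroup.relIndex_dvd_index_of_normal U _
  have hclosed : IsClosed ((κ.kerSubgroup ⊓ galRange (K := ℚ) K : Subgroup _) :
      Set (Field.absoluteGaloisGroup ℚ)) := by
    rw [Subgroup.coe_inf]
    exact κ.isClosed_kerSubgroup.inter (Subgroup.isClosed_of_isOpen _ (isOpen_galRange K))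
  exact selmerRelRestriction_bijective_of_coprime V p (inf_le_kerInf K p κ U) hU rfl hclosed
    (Nat.Coprime.coprime_dvd_left hrel hcop)

include hU hcop in
/-- Injectivity of restriction on Selmer classes over `ℚ̄^{ker κ ⊓ galRange K}`. [folklore] -/
theorem resOfLe_injOn_selmerGroupOver
    {s s' : V.subgroupH1 p (κ.kerSubgroup ⊓ galRange (K := ℚ) K)}
    (hs : s ∈ V.selmerGroupOver p _) (hs' : s' ∈ V.selmerGroupOver p _)
    (h : V.resOfLe p (inf_le_kerInf K p κ U) s = V.resOfLe p (inf_le_kerInf K p κ U) s') :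
    s = s' := by
  have hinj := (selmerRelRestriction_kerInf_bijective V K p κ U hU hcop).1
  have := @hinj ⟨s, hs⟩ ⟨s', hs'⟩ (Subtype.ext (by
    rw [coe_selmerRelRestriction, coe_selmerRelRestriction]; exact h))
  exact congrArg Subtype.val this

omit [V.IsElliptic] in
/-- The eigen-restriction as a homomorphism `chiEigenSelmer V K p κ →+ chiEigenSelmerIn V K p κ U`
(restriction of classes). [folklore] -/
def chiEigenRestrictionHom : chiEigenSelmer V K p κ →+ chiEigenSelmerIn V K p κ U where
  toFun s := ⟨V.resOfLe p (inf_le_kerInf K p κ U) (s : V.subgroupH1 p (κ.kerSubgroup ⊓ galRange (K := ℚ) K)),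
    resOfLe_mem_chiEigenSelmerIn V K p κ U s.2⟩
  map_zero' := Subtype.ext (by simp only [ZeroMemClass.coe_zero, map_zero])
  map_add' s s' := Subtype.ext (by simp only [AddMemClass.coe_add, map_add])

omit [V.IsElliptic] in
/-- Values of `chiEigenRestrictionHom`. [folklore] -/
theorem coe_chiEigenRestrictionHom (s : chiEigenSelmer V K p κ) :
    ((chiEigenRestrictionHom V K p κ U s : chiEigenSelmerIn V K p κ U) :
        V.subgroupH1 p (κ.kerSubgroup ⊓ galRange (K := ℚ) K ⊓ U)) =
      V.resOfLe p (inf_le_kerInf K p κ U) (s : V.subgroupH1 p (κ.kerSubgroup ⊓ galRange (K := ℚ) K)) :=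
  rfl

include hU hcop in
/-- **The eigen-restriction is a bijection** `chiEigenSelmer V K p κ → chiEigenSelmerIn V K p κ U`
for `U` open normal with `p ∤ [Γ_ℚ : U]`: injective as a restriction of additive-p1's bijection;
surjective because a `χ_K`-variant class downstairs is `H'`-invariant (so it is the restriction of a
Selmer class `s`), and `s` is `χ_K`-variant by injectivity (`res (g_* s) = g_* (res s) = χ(g) res s =
res (χ(g) s)`). [cite: GreenbergLNM1716, §5 p. 143] -/
theorem chiEigenRestrictionHom_bijective :
    Function.Bijective (chiEigenRestrictionHom V K p κ U) := by
  refine ⟨fun s s' h ↦ Subtype.ext (resOfLe_injOn_selmerGroupOver V K p κ U hU hcop s.2.1 s'.2.1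
    (congrArg (fun x : chiEigenSelmerIn V K p κ U ↦
      (x : V.subgroupH1 p (κ.kerSubgroup ⊓ galRange (K := ℚ) K ⊓ U))) h)), fun t ↦ ?_⟩
  obtain ⟨s, hs⟩ := (selmerRelRestriction_kerInf_bijective V K p κ U hU hcop).2
    ⟨t, mem_selmerGroupOverRelInvariants_of_mem_chiEigenSelmerIn V K p κ U t.2⟩
  have hst : V.resOfLe p (inf_le_kerInf K p κ U)
      (s : V.subgroupH1 p (κ.kerSubgroup ⊓ galRange (K := ℚ) K)) = t := by
    have := congrArg (fun x : V.selmerGroupOverRelInvariants p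
        (κ.kerSubgroup ⊓ galRange (K := ℚ) K ⊓ U) (κ.kerSubgroup ⊓ galRange (K := ℚ) K) ↦
      (x : V.subgroupH1 p (κ.kerSubgroup ⊓ galRange (K := ℚ) K ⊓ U))) hs
    simpa only [coe_selmerRelRestriction] using this
  refine ⟨⟨s, s.2, fun g ↦ ?_⟩, Subtype.ext hst⟩
  -- `g_* s` and `χ(g) • s` are Selmer classes with the same restriction
  apply resOfLe_injOn_selmerGroupOver V K p κ U hU hcop
    (V.map_conjH1_selmerGroupOver_le_holds p _ _ ⟨s, s.2, rfl⟩) (AddSubgroup.zsmul_mem _ s.2 _)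
  rw [resOfLe_conjH1, map_zsmul, hst]
  exact t.2.2 g

include hU hcop in
/-- **The eigen-descent isomorphism `Sel_{p^∞}(E♭/K·ℚ_∞)^{(χ_K)} ≃+ Sel_{p^∞}(E♭/F·K·ℚ_∞)^{(χ_K)}`**
(restriction; `F = ℚ̄^U`, `U` open normal, `p ∤ [Γ_ℚ : U]`). For `U = galRange F`,
`F = ℚ(ζ_p) ⊃ K = ℚ(√p*)`: `Sel_{p^∞}(E♭/ℚ_∞(√p*))^{(χ_K)} ≃ e_{(p−1)/2}·Sel_{p^∞}(E♭/ℚ(μ_{p^∞}))` — the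
prime-to-`p` descent along `Gal(ℚ(μ_{p^∞})/ℚ_∞(√p*))`, of order `(p−1)/2`.
[cite: GreenbergLNM1716, §5 p. 143] -/
def chiEigenRestrictionEquiv : chiEigenSelmer V K p κ ≃+ chiEigenSelmerIn V K p κ U :=
  AddEquiv.ofBijective (chiEigenRestrictionHom V K p κ U)
    (chiEigenRestrictionHom_bijective V K p κ U hU hcop)

/-- Values of `chiEigenRestrictionEquiv`: the restricted class. [folklore] -/
theorem coe_chiEigenRestrictionEquiv (s : chiEigenSelmer V K p κ) :
    ((chiEigenRestrictionEquiv V K p κ U hU hcop s : chiEigenSelmerIn V K p κ U) :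
        V.subgroupH1 p (κ.kerSubgroup ⊓ galRange (K := ℚ) K ⊓ U)) =
      V.resOfLe p (inf_le_kerInf K p κ U) (s : V.subgroupH1 p (κ.kerSubgroup ⊓ galRange (K := ℚ) K)) :=
  rfl

/-- **Equivariance for every `γ ∈ Γ_ℚ`**: the eigen-descent commutes with `γ_*` (restriction
commutes with conjugation). In particular the `Λ`-structures `T = γ_* − 1` match for ANY choice of
topological generator. [cite: NeukirchSchmidtWingberg2008, I.§5] -/
theorem coe_chiEigenRestrictionEquiv_conjH1 (γ : Field.absoluteGaloisGroup ℚ)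
    (s : chiEigenSelmer V K p κ) :
    ((chiEigenRestrictionEquiv V K p κ U hU hcop
        ⟨V.conjH1 p _ γ s, conjH1_mem_chiEigenSelmer V K κ γ s.2⟩ : chiEigenSelmerIn V K p κ U) :
        V.subgroupH1 p (κ.kerSubgroup ⊓ galRange (K := ℚ) K ⊓ U)) =
      V.conjH1 p _ γ ((chiEigenRestrictionEquiv V K p κ U hU hcop s : chiEigenSelmerIn V K p κ U) :
        V.subgroupH1 p (κ.kerSubgroup ⊓ galRange (K := ℚ) K ⊓ U)) := by
  rw [coe_chiEigenRestrictionEquiv, coe_chiEigenRestrictionEquiv]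
  exact resOfLe_conjH1 V K p κ U γ _

/-- The inverse eigen-descent also commutes with `γ_*`. [folklore] -/
theorem coe_chiEigenRestrictionEquiv_symm_conjH1 (γ : Field.absoluteGaloisGroup ℚ)
    (t : chiEigenSelmerIn V K p κ U) :
    (((chiEigenRestrictionEquiv V K p κ U hU hcop).symm
        ⟨V.conjH1 p _ γ t, conjH1_mem_chiEigenSelmerIn γ t.2⟩ : chiEigenSelmer V K p κ) :
        V.subgroupH1 p (κ.kerSubgroup ⊓ galRange (K := ℚ) K)) =
      V.conjH1 p _ γ (((chiEigenRestrictionEquiv V K p κ U hU hcop).symm t : chiEigenSelmer V K p κ) :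
        V.subgroupH1 p (κ.kerSubgroup ⊓ galRange (K := ℚ) K)) := by
  set e := chiEigenRestrictionEquiv V K p κ U hU hcop with he
  set s := e.symm t with hs
  have ht : e ⟨V.conjH1 p _ γ s, conjH1_mem_chiEigenSelmer V K κ γ s.2⟩ =
      ⟨V.conjH1 p _ γ t, conjH1_mem_chiEigenSelmerIn γ t.2⟩ := by
    apply Subtype.ext
    rw [he, coe_chiEigenRestrictionEquiv_conjH1, ← he]
    change V.conjH1 p _ γ ((e (e.symm t) : chiEigenSelmerIn V K p κ U) :
      V.subgroupH1 p (κ.kerSubgroup ⊓ galRange (K := ℚ) K ⊓ U)) = _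
    rw [AddEquiv.apply_symm_apply]
  rw [← ht, AddEquiv.symm_apply_apply]

end Restriction

end Summit.BirchSwinnertonDyer.Rank1Residual.Additive

end
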